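import Summits.AtomisticToContinuum.Crystallization.Theses.PhononSlackCertificates
import Summits.AtomisticToContinuum.Crystallization.Theorems.ReggeStarCoercivityStarCoercivitySeparationRemoval
import Summits.AtomisticToContinuum.Crystallization.Theorems.PhononSlackCertificatesAllBadGapFloor

/-!
# Route `PhononSlackCertificates`, crux `CoerciveTwoShellGap` (stmt-AtomisticToContinuum-13956),
line `Sketch`: stub `stub_sepReduction` — SEPARATION IS REMOVABLE

If the two-shell gap `N·e* + g·#bad(x) ≤ 𝓔_LJ(x)` holds with one `g > 0` for every
`1/3`-SEPARATED configuration `x : Fin N → ℝ³` (`e* = ⨅_Q e(Q)` over periodic configurations,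
`#bad(x)` = number of particles that are not `1/20`-good, `IsTwoShellGood (1/20) (47/50) 1`), then
the crux `CoerciveTwoShellGap` holds for EVERY `δ > 0`, with the uniform constant
`g' = min g (−e*/83)`.

PROOF (a port of `stub_separationRemoval`, file
`ReggeStarCoercivityStarCoercivitySeparationRemoval.lean`, to the two-shell predicate).
(0) `N = 1`: one particle has energy `0` and is bad (a goodness witness assigns `18` pattern
points to OTHER particles), so `e* + g ≤ 0`; hence `e* < 0`, `0 < g' ≤ g` and `83·g' ≤ −e*`.
(1) A `δ`-separated `x` is injective; prove `N·e* + g'·#bad(x) ≤ 𝓔(x)` for all INJECTIVE `x` by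
strong induction on `N`.  Separated case: the hypothesis.  Otherwise a closest pair `(i₀, j₀)` at
distance `0 < r < 1/3`; delete `i₀`: `𝓔(x) = 𝓔(x ∖ i₀) + 𝓔^{i₀}(x)`
(`separationRemoval_interactionEnergy_succAbove`), `𝓔^{i₀}(x) > 0`
(`separationRemoval_siteEnergy_pos_of_closest`), and `#bad(x) ≤ #bad(x ∖ i₀) + 83`
(`bad_le_succ`): statuses are unchanged beyond distance `3/2` of `x i₀` (a `1/20`-matched
particle lies within `(1/20 + √2)·a < 3/2` of its centre), and particles good after the deletion
are `893/1000`-isolated (`dist_ge_of_good`), so at most `(2·(3/2)/(893/1000) + 1)³ < 83` of them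
lie within `3/2` of `x i₀` (`card_le_of_separated_of_dist_le`); the abstract recount is the tree's
`separationRemoval_card_not_le`.  Then `(n+1)·e* + g'·#bad(x) ≤ n·e* + g'·#bad(x ∖ i₀) + (e* + 83 g')
≤ 𝓔(x ∖ i₀) < 𝓔(x)`.
No definitions; all `[folklore]`.
-/

noncomputable section

namespace Summit.AtomisticToContinuum.Crystallization.Theorems.CoerciveTwoShellGapSepReduction

open scoped BigOperators Classical
open Literature.MathematicalPhysics.StatisticalMechanics Literature.Geometry.DiscreteGeometry

/-- **A `1/20`-good particle is `893/1000`-isolated**: a particle `j ≠ i` within `3a/2` of a good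
particle `i` is matched to a pattern point at distance `≥ a` up to the tolerance `a/20`, hence lies
at distance `≥ (19/20)·a ≥ (19/20)·(47/50) = 893/1000`; the others are at distance `> 3a/2 ≥ 1.41`.
[folklore] -/
theorem dist_ge_of_good {N : ℕ} {x : Fin N → EuclideanSpace ℝ (Fin 3)} {i : Fin N}
    (h : IsTwoShellGood (1 / 20) (47 / 50) 1 x i) {j : Fin N} (hj : j ≠ i) :
    893 / 1000 ≤ dist (x j) (x i) := by
  -- adapted from Cruxes/CoerciveTwoShellGap/IdeatorTwoSketch.lean (not an importable module)
  obtain ⟨a, ha₁, ha₂, A, P, f, hP, hf, hinj, hsurj⟩ := h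
  have ha0 : 0 ≤ a := le_trans (by norm_num) ha₁
  by_cases hd : dist (x j) (x i) ≤ 3 / 2 * a
  · obtain ⟨v, hv, rfl⟩ := hsurj j hj hd
    have hv1 : 1 ≤ ‖v‖ := by
      have h2 : (1 : ℝ) ≤ Real.sqrt 2 := Real.one_le_sqrt.mpr (by norm_num)
      rcases hP with rfl | rfl
      · rcases norm_of_mem_fccTwoShellPattern hv with h | h
        · rw [h]
        · rw [h]; exact h2
      · rcases norm_of_mem_hcpTwoShellPattern hv with h | h
        · rw [h]
        · rw [h]; exact h2
    have hAv : a ≤ dist (x i + a • A v) (x i) := by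
      rw [dist_eq_norm, add_sub_cancel_left, norm_smul, Real.norm_of_nonneg ha0, A.norm_map]
      nlinarith
    have hmatch : dist (x (f v)) (x i + a • A v) ≤ 1 / 20 * a := (hf v hv).2
    have htri : dist (x i + a • A v) (x i) ≤
        dist (x i + a • A v) (x (f v)) + dist (x (f v)) (x i) := dist_triangle _ _ _
    rw [dist_comm (x i + a • A v) (x (f v))] at htri
    nlinarith
  · push Not at hd
    nlinarith

/-- **A matched particle lies within `3/2` of the centre**: if `dist p (c + a • A v) ≤ a/20` with
`v` a two-shell pattern point (`‖v‖ ≤ √2`), `A` a linear isometry and `a ≤ 1`, then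
`dist p c ≤ (1/20 + √2)·a < 3/2`. [folklore] -/
theorem dist_lt_of_matched {a : ℝ} (ha₁ : 47 / 50 ≤ a) (ha₂ : a ≤ 1)
    (A : EuclideanSpace ℝ (Fin 3) →ₗᵢ[ℝ] EuclideanSpace ℝ (Fin 3))
    {P : Finset (EuclideanSpace ℝ (Fin 3))} (hP : P = fccTwoShellPattern ∨ P = hcpTwoShellPattern)
    {v : EuclideanSpace ℝ (Fin 3)} (hv : v ∈ P) {p c : EuclideanSpace ℝ (Fin 3)}
    (h : dist p (c + a • A v) ≤ 1 / 20 * a) : dist p c < 3 / 2 := by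
  have ha0 : 0 ≤ a := le_trans (by norm_num) ha₁
  have hs : Real.sqrt 2 < 1415 / 1000 := by
    rw [Real.sqrt_lt' (by norm_num)]
    norm_num
  have hAv : ‖a • A v‖ ≤ a * Real.sqrt 2 := by
    rw [norm_smul, Real.norm_of_nonneg ha0, A.norm_map]
    exact mul_le_mul_of_nonneg_left (norm_le_sqrt_two_of_mem_twoShellPattern hP hv) ha0
  have h2 : a * Real.sqrt 2 ≤ 1 * Real.sqrt 2 := mul_le_mul_of_nonneg_right ha₂ (Real.sqrt_nonneg 2)
  calc dist p c ≤ dist p (c + a • A v) + dist (c + a • A v) c := dist_triangle _ _ _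
    _ ≤ 1 / 20 * a + a * Real.sqrt 2 := by
        refine add_le_add h ?_
        rwa [dist_eq_norm, add_sub_cancel_left]
    _ < 3 / 2 := by linarith

/-- **Far statuses are unchanged by a deletion**: if `x (i₀.succAbove i')` is farther than `3/2`
from the deleted particle `x i₀`, then `i₀.succAbove i'` is `1/20`-good in `x` iff `i'` is
`1/20`-good in `x ∘ i₀.succAbove` (no pattern point can be matched to `i₀`, and `i₀` is outside the
`3a/2 ≤ 3/2`-neighbourhood that has to be covered; transport the assignment along `i₀.succAbove`).
[folklore] -/
theorem good_succAbove_iff {n : ℕ} (x : Fin (n + 1) → EuclideanSpace ℝ (Fin 3)) (i₀ : Fin (n + 1))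
    {i' : Fin n} (hfar : ¬ dist (x (i₀.succAbove i')) (x i₀) ≤ 3 / 2) :
    IsTwoShellGood (1 / 20) (47 / 50) 1 x (i₀.succAbove i') ↔
      IsTwoShellGood (1 / 20) (47 / 50) 1 (x ∘ i₀.succAbove) i' := by
  haveI : Nonempty (Fin n) := ⟨i'⟩
  constructor
  · rintro ⟨a, ha₁, ha₂, A, P, f, hP, hf, hinj, hsurj⟩
    -- no pattern point is matched to the deleted particle `i₀`
    have hne : ∀ v ∈ P, f v ≠ i₀ := by
      intro v hv h
      have hlt := dist_lt_of_matched ha₁ ha₂ A hP hv (hf v hv).2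
      rw [h, dist_comm] at hlt
      exact hfar hlt.le
    set f' : EuclideanSpace ℝ (Fin 3) → Fin n := fun v => Function.invFun i₀.succAbove (f v) with hf'
    have key : ∀ v ∈ P, i₀.succAbove (f' v) = f v := fun v hv =>
      Function.invFun_eq (Fin.exists_succAbove_eq (hne v hv))
    refine ⟨a, ha₁, ha₂, A, P, f', hP, fun v hv => ⟨fun h => (hf v hv).1 ?_, ?_⟩,
      fun v hv w hw hvw => hinj hv hw ?_, fun j' hj' hd => ?_⟩
    · rw [← key v hv, h]
    · show dist (x (i₀.succAbove (f' v))) (x (i₀.succAbove i') + a • A v) ≤ 1 / 20 * a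
      rw [key v hv]
      exact (hf v hv).2
    · rw [← key v hv, ← key w hw, hvw]
    · obtain ⟨v, hv, hfv⟩ :=
        hsurj (i₀.succAbove j') (fun h => hj' (Fin.succAbove_right_injective h)) hd
      exact ⟨v, hv, Fin.succAbove_right_injective (p := i₀) (by rw [key v hv, hfv])⟩
  · rintro ⟨a, ha₁, ha₂, A, P, f', hP, hf, hinj, hsurj⟩
    set f : EuclideanSpace ℝ (Fin 3) → Fin (n + 1) := fun v => i₀.succAbove (f' v) with hf_def
    refine ⟨a, ha₁, ha₂, A, P, f, hP,
      fun v hv => ⟨fun h => (hf v hv).1 (Fin.succAbove_right_injective h), (hf v hv).2⟩,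
      fun v hv w hw hvw => hinj hv hw (Fin.succAbove_right_injective hvw), fun j hj hd => ?_⟩
    rcases Fin.eq_self_or_eq_succAbove i₀ j with rfl | ⟨j', rfl⟩
    · exfalso
      apply hfar
      rw [dist_comm]
      linarith
    · have hj' : j' ≠ i' := fun h => hj (by rw [h])
      obtain ⟨v, hv, hfv⟩ := hsurj j' hj' hd
      exact ⟨v, hv, show i₀.succAbove (f' v) = i₀.succAbove j' by rw [hfv]⟩

/-- **The packing count behind `83`**: at most `82` points with pairwise distances `≥ 893/1000` lie
in a closed ball of radius `3/2` of `ℝ³` (`(2·(3/2)/(893/1000) + 1)³ = 82.85… < 83`). [folklore] -/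
theorem card_le_82 (s : Finset (EuclideanSpace ℝ (Fin 3))) (p : EuclideanSpace ℝ (Fin 3))
    (hs : ∀ c ∈ s, dist c p ≤ 3 / 2) (hsep : ∀ c ∈ s, ∀ d ∈ s, c ≠ d → (893 / 1000 : ℝ) ≤ dist c d) :
    s.card ≤ 82 := by
  -- adapted from `separationRemoval_card_le_55`
  have h := card_le_of_separated_of_dist_le s p (by norm_num : (0 : ℝ) < 893 / 1000)
    (by norm_num : (0 : ℝ) ≤ 3 / 2) hs hsep
  rw [finrank_euclideanSpace, Fintype.card_fin] at h
  exact Nat.lt_succ_iff.1 (by exact_mod_cast (lt_of_le_of_lt h (by norm_num) : (s.card : ℝ) < 83))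

/-- At most `82` particles of `x ∖ i₀` that are `1/20`-good there lie within `3/2` of the deleted
particle `x i₀` (their positions are distinct points of the closed `3/2`-ball about `x i₀`, pairwise
`≥ 893/1000` apart by `dist_ge_of_good`). [folklore] -/
theorem card_flip_le {n : ℕ} (x : Fin (n + 1) → EuclideanSpace ℝ (Fin 3)) (i₀ : Fin (n + 1))
    (hx : Function.Injective x) :
    ((Finset.univ.filter fun i' : Fin n => dist (x (i₀.succAbove i')) (x i₀) ≤ 3 / 2).filter
        fun i' : Fin n => IsTwoShellGood (1 / 20) (47 / 50) 1 (x ∘ i₀.succAbove) i').card ≤ 82 := by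
  -- adapted from `separationRemoval_card_flip_le`
  set x' : Fin n → EuclideanSpace ℝ (Fin 3) := x ∘ i₀.succAbove with hx'
  set F := ((Finset.univ.filter fun i' : Fin n => dist (x (i₀.succAbove i')) (x i₀) ≤ 3 / 2).filter
        fun i' : Fin n => IsTwoShellGood (1 / 20) (47 / 50) 1 x' i') with hF
  rw [← Finset.card_image_of_injective F (hx.comp Fin.succAbove_right_injective : Function.Injective x')]
  refine card_le_82 _ (x i₀) ?_ ?_
  · intro c hc
    obtain ⟨i', hi', rfl⟩ := Finset.mem_image.1 hc
    exact (Finset.mem_filter.1 (Finset.mem_filter.1 hi').1).2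
  · intro c hc d hd hcd
    obtain ⟨i', hi', rfl⟩ := Finset.mem_image.1 hc
    obtain ⟨k', hk', rfl⟩ := Finset.mem_image.1 hd
    have hik : k' ≠ i' := fun h => hcd (by rw [h])
    rw [dist_comm]
    exact dist_ge_of_good (Finset.mem_filter.1 hi').2 hik

/-- **Bad recount**: deleting one particle `i₀` of an injective configuration `x : Fin (n+1) → ℝ³`
raises the number of `1/20`-bad particles by at most `83 = 1 + 82` relative to the smaller
configuration `x ∘ i₀.succAbove`. [folklore] -/
theorem bad_le_succ {n : ℕ} (x : Fin (n + 1) → EuclideanSpace ℝ (Fin 3)) (i₀ : Fin (n + 1))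
    (hx : Function.Injective x) :
    Nat.card {i : Fin (n + 1) // ¬ IsTwoShellGood (1 / 20) (47 / 50) 1 x i} ≤
      Nat.card {i : Fin n // ¬ IsTwoShellGood (1 / 20) (47 / 50) 1 (x ∘ i₀.succAbove) i} + 83 := by
  have h := separationRemoval_card_not_le i₀
    (G := fun i : Fin (n + 1) => IsTwoShellGood (1 / 20) (47 / 50) 1 x i)
    (G' := fun i' : Fin n => IsTwoShellGood (1 / 20) (47 / 50) 1 (x ∘ i₀.succAbove) i')
    (Finset.univ.filter fun i' : Fin n => dist (x (i₀.succAbove i')) (x i₀) ≤ 3 / 2)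
    (fun i' hi' => good_succAbove_iff x i₀ (by simpa using hi'))
  have h82 := card_flip_le x i₀ hx
  omega

/-- **One particle is bad**: a goodness witness assigns the `18` pattern points to particles other
than the centre, impossible in `Fin 1`. [folklore] -/
theorem not_isTwoShellGood_fin_one (x : Fin 1 → EuclideanSpace ℝ (Fin 3)) (i : Fin 1) :
    ¬ IsTwoShellGood (1 / 20) (47 / 50) 1 x i := by
  rintro ⟨a, -, -, A, P, f, hP, hf, -, -⟩
  obtain ⟨v, hv⟩ : P.Nonempty :=
    Finset.card_pos.1 (by rw [card_eq_eighteen_of_twoShellPattern hP]; norm_num)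
  exact (hf v hv).1 (Subsingleton.elim _ _)

/-- **Separation reduction** (line `Sketch` of crux `CoerciveTwoShellGap`,
item `stmt-AtomisticToContinuum-13956`).  The two-shell gap for `1/3`-SEPARATED finite
configurations (one `g > 0`, no boundary allowance) implies the crux for EVERY `δ > 0`, with
`g' = min g (−e*/83)` uniformly in `δ`: `N = 1` forces `e* + g ≤ 0`; a `δ`-separated `x` is
injective; closest-pair deletion by strong induction on `N`
(`separationRemoval_interactionEnergy_succAbove`, `separationRemoval_siteEnergy_pos_of_closest`,
`bad_le_succ`). [folklore] -/
theorem stub_sepReduction :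
    (∃ g : ℝ, 0 < g ∧ ∀ (N : ℕ) (x : Fin N → EuclideanSpace ℝ (Fin 3)),
        (∀ i j : Fin N, i ≠ j → (1 / 3 : ℝ) ≤ dist (x i) (x j)) →
        (N : ℝ) * (⨅ Q : PeriodicConfiguration 3, Q.energyPerParticle lennardJones)
          + g * (Nat.card {i : Fin N // ¬ IsTwoShellGood (1 / 20) (47 / 50) 1 x i} : ℝ)
          ≤ interactionEnergy lennardJones x) →
    Summit.AtomisticToContinuum.Crystallization.Theses.PhononSlackCertificates.CoerciveTwoShellGap := by
  unfold Summit.AtomisticToContinuum.Crystallization.Theses.PhononSlackCertificates.CoerciveTwoShellGap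
  rintro ⟨g, hg, hG⟩ δ hδ
  set eP : ℝ := (⨅ Q : PeriodicConfiguration 3, Q.energyPerParticle lennardJones) with heP
  -- Step (0): one particle is bad and has energy `0`, so `e* + g ≤ 0`
  have hgle : eP + g ≤ 0 := by
    have h1 := hG 1 (fun _ => 0) (fun i j hij => absurd (Subsingleton.elim i j) hij)
    rw [Nat.card_congr (Equiv.subtypeUnivEquiv (not_isTwoShellGood_fin_one (fun _ => 0))),
      Nat.card_eq_fintype_card, Fintype.card_fin, interactionEnergy_of_subsingleton] at h1
    simp only [Nat.cast_one, one_mul, mul_one] at h1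
    exact h1
  have he : eP < 0 := by linarith
  set g' : ℝ := min g (-eP / 83) with hg'
  have hg'0 : 0 < g' := lt_min hg (div_pos (by linarith) (by norm_num))
  have hg'g : g' ≤ g := min_le_left _ _
  have h83 : 83 * g' ≤ -eP := by
    have := min_le_right g (-eP / 83)
    rw [le_div_iff₀ (by norm_num : (0 : ℝ) < 83)] at this
    linarith
  refine ⟨g', hg'0, ?_⟩
  -- Step (1): the `δ`-free statement for injective configurations, by strong induction on `N`
  suffices main : ∀ (N : ℕ) (x : Fin N → EuclideanSpace ℝ (Fin 3)), Function.Injective x →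
      (N : ℝ) * eP + g' * (Nat.card {i : Fin N // ¬ IsTwoShellGood (1 / 20) (47 / 50) 1 x i} : ℝ) ≤
        interactionEnergy lennardJones x from
    fun N x hsep => main N x (PhononSlackCertificatesAllBadGapFloor.injective_of_separated hδ hsep)
  intro N
  induction N using Nat.strong_induction_on with
  | _ N ih =>
  intro x hx
  by_cases hs : ∀ i j : Fin N, i ≠ j → (1 / 3 : ℝ) ≤ dist (x i) (x j)
  · -- separated: the hypothesis with the weaker constant
    have h := hG N x hs
    have hD : (0 : ℝ) ≤ (Nat.card {i : Fin N // ¬ IsTwoShellGood (1 / 20) (47 / 50) 1 x i} : ℝ) :=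
      Nat.cast_nonneg _
    linarith [mul_le_mul_of_nonneg_right hg'g hD]
  · -- a closest pair `(i₀, j₀)` at distance `r < 1/3`; delete `i₀`
    push Not at hs
    obtain ⟨i₁, j₁, hij₁, hlt⟩ := hs
    obtain ⟨p, hp, hmin⟩ := Finset.exists_min_image Finset.univ.offDiag
      (fun p : Fin N × Fin N => dist (x p.1) (x p.2)) ⟨(i₁, j₁), by simp [hij₁]⟩
    obtain ⟨i₀, j₀⟩ := p
    have hij₀ : i₀ ≠ j₀ := by simpa using hp
    have hr : 0 < dist (x i₀) (x j₀) := dist_pos.2 (hx.ne hij₀)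
    have hsepr : ∀ k l, k ≠ l → dist (x i₀) (x j₀) ≤ dist (x k) (x l) := fun k l hkl =>
      hmin (k, l) (by simp [hkl])
    have hr3 : dist (x i₀) (x j₀) < 1 / 3 := (hsepr i₁ j₁ hij₁).trans_lt hlt
    obtain ⟨n, rfl⟩ : ∃ n, N = n + 1 := Nat.exists_eq_succ_of_ne_zero (Fin.pos i₀).ne'
    set x' : Fin n → EuclideanSpace ℝ (Fin 3) := x ∘ i₀.succAbove with hx'
    have hih := ih n (Nat.lt_succ_self n) x' (hx.comp Fin.succAbove_right_injective)
    have hE : interactionEnergy lennardJones x =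
        interactionEnergy lennardJones x' + siteEnergy lennardJones x i₀ :=
      separationRemoval_interactionEnergy_succAbove lennardJones x i₀
    have hsite : 0 < siteEnergy lennardJones x i₀ :=
      separationRemoval_siteEnergy_pos_of_closest x hr hr3 hsepr hij₀ rfl
    have hdef : (Nat.card {i : Fin (n + 1) // ¬ IsTwoShellGood (1 / 20) (47 / 50) 1 x i} : ℝ) ≤
        (Nat.card {i : Fin n // ¬ IsTwoShellGood (1 / 20) (47 / 50) 1 x' i} : ℝ) + 83 := by
      exact_mod_cast bad_le_succ x i₀ hx
    push_cast at hih ⊢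
    linarith [mul_le_mul_of_nonneg_left hdef hg'0.le]

end Summit.AtomisticToContinuum.Crystallization.Theorems.CoerciveTwoShellGapSepReduction

end
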